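import Summits.Parity.GeneralizedHardyLittlewood.Theorems.LiouvilleShiftedTablesEHOfTopWindowPurity
import Summits.Parity.GeneralizedHardyLittlewood.Theorems.LiouvilleShiftedTablesEHLevelOfPurityAt
import Summits.Parity.GeneralizedHardyLittlewood.Theorems.LiouvilleShiftedTablesEHStubPurityOfWindowMoment

/-!
# `EH` from window moment bounds (crux `stmt-Parity-11314`, line `upward-replication-free-factorability`)

The kernel-checked CONDITIONAL content of the line after reshape 2 (lead prover-line-stmt-Parity-11314-1,
2026-08-16): the former open stub (power-sparse top-window purity of the conductor-excised
discrepancy) is Markov's inequality applied to a MOMENT statement, and the Markov step is a theorem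
of the tree (`PurityOfMoment.stub_purity_of_windowMoment`).  Composing it with the landed bridges
`OfTopWindowPurity.eh_of_topWindowPurity` (all windows ⟹ the Elliott–Halberstam conjecture verbatim)
and `OfTopWindowPurity.eh_level_of_purityAt` (one window ⟹ every level below it) gives:

* `eh_of_windowMoments`: if for every window exponent `0 < ε' ≤ 1/2` some `2k`-th moment of the
  maximal conductor-excised discrepancy `E♯(x; m) = max_{a unit} ‖φ(m)⁻¹ ∑_{cond χ > ⌊x^{1/2−δ₀}⌋} χ(a⁻¹) ψ(x, χ)‖`
  over the window `m ∈ (x^{1−ε'}, 2x^{1−ε'}]`, outside a power-sparse exceptional set, has a power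
  saving — `∑_{m ∼ M, m ∉ E} E♯(x; m)^{2k} ≤ x^{2k−η}/M^{2k−1}`, `M = x^{1−ε'}`, `#E ≤ x^{1−ε'−η}` — then
  `EH` (both route decls);
* `eh_level_of_momentAt` (graded): the same moment bound in the SINGLE window `x^{1−ε'}` (any
  `ε' > 0`) already gives `Literature.NumberTheory.Sieve.EH θ` for every `θ < 1 − ε'`.

Status of the hypothesis (the line's one open stub `stub_windowMoment`, conjecture-grade): it is the
top rung of the moment ladder (`Cruxes/EH/Ideas/moment-ladder-pattern-complexity.md`) in its weakest,
max-inside form; consistent with the random model (`∑_{m∼M} E♯^{2k} ≈ M (x/M)^k (log x)^{O(k)}`, so any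
`k ≥ 1` with `kε' > η` fits); implied by Montgomery's conjecture for `Δ♯`; KNOWN only through the
`ℓ²` large sieve / Barban–Davenport–Halberstam (`k = 1`, bound `(M + x^{1/2+δ₀}) x (log x)²`), which
meets the required `x^{2−η}/M` exactly when `ε' > 1/2`, i.e. below `x^{1/2}` (conclusion: Bombieri–
Vinogradov); no `2k`-th moment with `k ≥ 2` is known for any `M ≤ x^{1−δ}` (third moments: Hooley,
*On the Barban–Davenport–Halberstam theorem* VIII–IX, Vaughan 2003 — only for `M > x/(log x)^A`).
So these theorems are honest conditional bridges: a `2k`-th-moment power saving just above `x^{1/2}`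
would give the primes a level of distribution beyond `1/2`.

References: H. Davenport, *Multiplicative Number Theory*, ch. 28–29; H. Iwaniec, E. Kowalski,
*Analytic Number Theory*, §17.1–17.4; C. Hooley, J. reine angew. Math. 274/275 (1975) and the BDH
series; R. C. Vaughan, Phil. Trans. R. Soc. A 361 (2003).
-/

open Finset Real Filter Asymptotics

namespace Summit.Parity.GeneralizedHardyLittlewood.Theorems.EH.OfWindowMoments

/-- **Purity of one window from a moment bound in that window** (graded Markov step): for a window
exponent `ε'` (no size constraint needed), if there are `δ₀ ∈ (0, 1/2)`, `k`, `η > 0`, `x₀` such that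
for `x ≥ x₀` the `2k`-th moment of `E♯(x; m)` over `m ∈ (x^{1−ε'}, 2x^{1−ε'}]` outside a set of size
`≤ x^{1−ε'−η}` is `≤ x^{2k−η}/(x^{1−ε'})^{2k−1}`, then for every `B > 0` all moduli of the window
outside a set of size `≤ x^{1−ε'−η/2}` satisfy `E♯(x; m) < x/(φ(m)(log x)^B)` for `x` large.  Same
proof as `PurityOfMoment.stub_purity_of_windowMoment`, one window at a time. [folklore] -/
theorem purityAt_of_momentAt (ε' : ℝ)
    (hMomentAt : ∃ δ₀ : ℝ, 0 < δ₀ ∧ δ₀ < 1 / 2 ∧ ∃ k : ℕ, ∃ η : ℝ, 0 < η ∧ ∃ x₀ : ℝ, ∀ x : ℝ, x₀ ≤ x →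
        ∃ E : Finset ℕ, (E.card : ℝ) ≤ x ^ (1 - ε' - η) ∧
          ∑ m ∈ (Finset.Ioc ⌊x ^ (1 - ε')⌋₊ ⌊2 * x ^ (1 - ε')⌋₊ \ E),
              (⨆ a : (ZMod m)ˣ,
                  ‖((Nat.totient m : ℂ))⁻¹ *
                      ∑ χ ∈ (Finset.univ : Finset (DirichletCharacter ℂ m)) with
                          ⌊x ^ (1 / 2 - δ₀)⌋₊ < χ.conductor,
                        χ (a : ZMod m)⁻¹ * Literature.NumberTheory.Sieve.chebyshevPsiChar χ x‖) ^ (2 * k) ≤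
            x ^ (2 * (k : ℝ) - η) / (x ^ (1 - ε')) ^ (2 * (k : ℝ) - 1)) :
    ∀ B : ℝ, 0 < B →
      ∃ δ₀ : ℝ, 0 < δ₀ ∧ δ₀ < 1 / 2 ∧ ∃ η : ℝ, 0 < η ∧ ∃ x₀ : ℝ, ∀ x : ℝ, x₀ ≤ x →
        ∃ I : Finset ℕ, (I.card : ℝ) ≤ x ^ (1 - ε' - η) ∧
          ∀ m ∈ Finset.Ioc ⌊x ^ (1 - ε')⌋₊ ⌊2 * x ^ (1 - ε')⌋₊, m ∉ I →
            (⨆ a : (ZMod m)ˣ,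
                ‖((Nat.totient m : ℂ))⁻¹ *
                    ∑ χ ∈ (Finset.univ : Finset (DirichletCharacter ℂ m)) with
                        ⌊x ^ (1 / 2 - δ₀)⌋₊ < χ.conductor,
                      χ (a : ZMod m)⁻¹ * Literature.NumberTheory.Sieve.chebyshevPsiChar χ x‖) <
              x / ((Nat.totient m : ℝ) * Real.log x ^ B) := by
  intro B _
  obtain ⟨δ₀, hδ₀, hδ₀', k, η, hη, x₀, hx₀⟩ := hMomentAt
  obtain ⟨X, hX⟩ := Filter.eventually_atTop.1
    (PurityOfMoment.eventually_one_add_mul_log_rpow_le k B (half_pos hη))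
  refine ⟨δ₀, hδ₀, hδ₀', η / 2, half_pos hη, max x₀ X, fun x hx => ?_⟩
  obtain ⟨hx2, hev⟩ := hX x ((le_max_right _ _).trans hx)
  obtain ⟨E, hE, hsum⟩ := hx₀ x ((le_max_left _ _).trans hx)
  have hx0 : 0 < x := by linarith
  have hL : 0 < Real.log x := Real.log_pos (by linarith)
  have hM : 0 < x ^ (1 - ε') := Real.rpow_pos_of_pos hx0 _
  have hLB : 0 < Real.log x ^ B := Real.rpow_pos_of_pos hL _
  have hT : 0 < x / (2 * x ^ (1 - ε') * Real.log x ^ B) :=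
    div_pos hx0 (mul_pos (mul_pos two_pos hM) hLB)
  obtain ⟨I, hI, hpure⟩ := PurityOfMoment.exists_exceptional_set
    (S := Finset.Ioc ⌊x ^ (1 - ε')⌋₊ ⌊2 * x ^ (1 - ε')⌋₊) (E := E)
    (f := fun m => ⨆ a : (ZMod m)ˣ,
      ‖((Nat.totient m : ℂ))⁻¹ *
          ∑ χ ∈ (Finset.univ : Finset (DirichletCharacter ℂ m)) with
              ⌊x ^ (1 / 2 - δ₀)⌋₊ < χ.conductor,
            χ (a : ZMod m)⁻¹ * Literature.NumberTheory.Sieve.chebyshevPsiChar χ x‖)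
    (t := fun m => x / ((Nat.totient m : ℝ) * Real.log x ^ B))
    (T := x / (2 * x ^ (1 - ε') * Real.log x ^ B))
    (R := x ^ (2 * (k : ℝ) - η) / (x ^ (1 - ε')) ^ (2 * (k : ℝ) - 1)) (n := 2 * k)
    (fun m _ => Real.iSup_nonneg fun a => norm_nonneg _) hT
    (fun m hm => PurityOfMoment.threshold_le hx0.le hM.le hLB hm) hsum
  refine ⟨I, hI.trans ?_, hpure⟩
  rw [PurityOfMoment.moment_div_threshold_pow B η k hx0 hM hL, ← Real.rpow_add hx0,
    ← sub_eq_add_neg]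
  have hxe : 0 ≤ x ^ (1 - ε' - η) := Real.rpow_nonneg hx0.le _
  calc (E.card : ℝ) + 4 ^ k * x ^ (1 - ε' - η) * Real.log x ^ (2 * (k : ℝ) * B)
      ≤ x ^ (1 - ε' - η) + 4 ^ k * x ^ (1 - ε' - η) * Real.log x ^ (2 * (k : ℝ) * B) := by
        gcongr
    _ = x ^ (1 - ε' - η) * (1 + 4 ^ k * Real.log x ^ (2 * (k : ℝ) * B)) := by ring
    _ ≤ x ^ (1 - ε' - η) * x ^ (η / 2) := by gcongr
    _ = x ^ (1 - ε' - η / 2) := by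
        rw [← Real.rpow_add hx0]
        congr 1
        ring

/-- **A moment bound in one window gives every level below it** (graded bridge): for `ε' > 0`, a
`2k`-th-moment power saving for the maximal conductor-excised discrepancy in the single window of
moduli `(x^{1−ε'}, 2x^{1−ε'}]` (outside a power-sparse exceptional set) implies the Elliott–Halberstam
estimate `Literature.NumberTheory.Sieve.EH θ` (Wave0 form: for every real `A`,
`∑_{q ≤ x^θ} max_{a unit} |ψ(x; q, a) − x/φ(q)| = O(x/(log x)^A)`) for every `θ < 1 − ε'`.
Composition of `purityAt_of_momentAt` with the landed `OfTopWindowPurity.eh_level_of_purityAt`.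
In particular such a bound just above `x^{1/2}` would give a level of distribution beyond `1/2`; for
`ε' > 1/2` the hypothesis follows from the large sieve and the conclusion is Bombieri–Vinogradov.
[folklore] -/
theorem eh_level_of_momentAt (ε' : ℝ) (hε' : 0 < ε')
    (hMomentAt : ∃ δ₀ : ℝ, 0 < δ₀ ∧ δ₀ < 1 / 2 ∧ ∃ k : ℕ, ∃ η : ℝ, 0 < η ∧ ∃ x₀ : ℝ, ∀ x : ℝ, x₀ ≤ x →
        ∃ E : Finset ℕ, (E.card : ℝ) ≤ x ^ (1 - ε' - η) ∧
          ∑ m ∈ (Finset.Ioc ⌊x ^ (1 - ε')⌋₊ ⌊2 * x ^ (1 - ε')⌋₊ \ E),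
              (⨆ a : (ZMod m)ˣ,
                  ‖((Nat.totient m : ℂ))⁻¹ *
                      ∑ χ ∈ (Finset.univ : Finset (DirichletCharacter ℂ m)) with
                          ⌊x ^ (1 / 2 - δ₀)⌋₊ < χ.conductor,
                        χ (a : ZMod m)⁻¹ * Literature.NumberTheory.Sieve.chebyshevPsiChar χ x‖) ^ (2 * k) ≤
            x ^ (2 * (k : ℝ) - η) / (x ^ (1 - ε')) ^ (2 * (k : ℝ) - 1))
    (θ : ℝ) (hθ : θ < 1 - ε') :
    Literature.NumberTheory.Sieve.EH θ :=
  OfTopWindowPurity.eh_level_of_purityAt ε' hε' (purityAt_of_momentAt ε' hMomentAt) θ hθ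

/-- **Window moment bounds imply the Elliott–Halberstam conjecture** (route decl
`LiouvilleShiftedTables.EH`, i.e. EH verbatim with `max_{y ≤ x}` and level `x^{θ−ε}`): if every
window `x^{1−ε'}`, `0 < ε' ≤ 1/2`, carries some `2k`-th-moment power saving for the maximal
conductor-excised discrepancy outside a power-sparse exceptional set, then `EH`.  Composition of the
landed Markov step `PurityOfMoment.stub_purity_of_windowMoment` with the landed bridge
`OfTopWindowPurity.eh_of_topWindowPurity` (itself the composition of the line's stubs
`stub_lowConductor`, `stub_replication`, `stub_badModuliSparse`, `stub_descent` with the tree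
equivalence `elliottHalberstam_iff_wave0_holds`).  The hypothesis is the line's only open stub.
[folklore] -/
theorem eh_of_windowMoments
    (hMoment : ∀ ε' : ℝ, 0 < ε' → ε' ≤ 1 / 2 →
      ∃ δ₀ : ℝ, 0 < δ₀ ∧ δ₀ < 1 / 2 ∧ ∃ k : ℕ, ∃ η : ℝ, 0 < η ∧ ∃ x₀ : ℝ, ∀ x : ℝ, x₀ ≤ x →
        ∃ E : Finset ℕ, (E.card : ℝ) ≤ x ^ (1 - ε' - η) ∧
          ∑ m ∈ (Finset.Ioc ⌊x ^ (1 - ε')⌋₊ ⌊2 * x ^ (1 - ε')⌋₊ \ E),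
              (⨆ a : (ZMod m)ˣ,
                  ‖((Nat.totient m : ℂ))⁻¹ *
                      ∑ χ ∈ (Finset.univ : Finset (DirichletCharacter ℂ m)) with
                          ⌊x ^ (1 / 2 - δ₀)⌋₊ < χ.conductor,
                        χ (a : ZMod m)⁻¹ * Literature.NumberTheory.Sieve.chebyshevPsiChar χ x‖) ^ (2 * k) ≤
            x ^ (2 * (k : ℝ) - η) / (x ^ (1 - ε')) ^ (2 * (k : ℝ) - 1)) :
    Summit.Parity.GeneralizedHardyLittlewood.Theses.LiouvilleShiftedTables.EH :=
  OfTopWindowPurity.eh_of_topWindowPurity (PurityOfMoment.stub_purity_of_windowMoment hMoment)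

/-- The same implication for the second route wanting the crux, `RoughSemiprimeRigidity.EH`
(byte-identical body; definitional unfolding). [folklore] -/
theorem roughSemiprimeRigidity_eh_of_windowMoments
    (hMoment : ∀ ε' : ℝ, 0 < ε' → ε' ≤ 1 / 2 →
      ∃ δ₀ : ℝ, 0 < δ₀ ∧ δ₀ < 1 / 2 ∧ ∃ k : ℕ, ∃ η : ℝ, 0 < η ∧ ∃ x₀ : ℝ, ∀ x : ℝ, x₀ ≤ x →
        ∃ E : Finset ℕ, (E.card : ℝ) ≤ x ^ (1 - ε' - η) ∧
          ∑ m ∈ (Finset.Ioc ⌊x ^ (1 - ε')⌋₊ ⌊2 * x ^ (1 - ε')⌋₊ \ E),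
              (⨆ a : (ZMod m)ˣ,
                  ‖((Nat.totient m : ℂ))⁻¹ *
                      ∑ χ ∈ (Finset.univ : Finset (DirichletCharacter ℂ m)) with
                          ⌊x ^ (1 / 2 - δ₀)⌋₊ < χ.conductor,
                        χ (a : ZMod m)⁻¹ * Literature.NumberTheory.Sieve.chebyshevPsiChar χ x‖) ^ (2 * k) ≤
            x ^ (2 * (k : ℝ) - η) / (x ^ (1 - ε')) ^ (2 * (k : ℝ) - 1)) :
    Summit.Parity.GeneralizedHardyLittlewood.Theses.RoughSemiprimeRigidity.EH :=
  eh_of_windowMoments hMoment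

end Summit.Parity.GeneralizedHardyLittlewood.Theorems.EH.OfWindowMoments
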